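import Mathlib
import Summits.HodgeConjecture.FermatCycles.HodgeFermatDescentBB
import Summits.HodgeConjecture.FermatCycles.HodgeFermatPropDPrimeNFinal

/-!
# THE DESCENT AT THE LEVELS 15N AND 21N from (JP₁₅)/(JP₂₁) alone (`HodgeFermat/DescentBFinal.lean`; HF-G34b, final form); closes the statements `Descent15`, `Descent21`

Tree copy (whole module + the closing theorems) of the module `HodgeFermat/DescentBFinal.lean` of the sibling cell's standalone package
`run/shared/lean/pub/pub-hodgefermat/lean/HodgeFermat/` (85 lines, sha256 `596ae4ebb7e1a25c…`), source lines 20–85 (all: `descent15`,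
`noCoincidence15`, `descent21`, `noCoincidence21` — (JP) the ONLY hypothesis) + `descent15_holds : Descent15`, `descent21_holds : Descent21`.
Filed by cell `pub-hfermat`, seat prover-1 gen-4, on the COORDINATOR KEEPER RULING of 2026-08-25 (gem sweep H1: take the
off-gate kernel theorem `thmFstar` through the gate).  The three forms of THEOREM F* named `thmFstar` in the sibling package are
on-gate since 2026-08-25/26 (`HodgeFermatThmFstar.lean` = F* at the prime levels, HF-G32, seat gen-0; `HodgeFermatThmFstarN.lean` =
F*(3N), HF-G33, gen-2; `HodgeFermatPropDPrimeNFinal.lean` = PROPOSITION D′(3N) and THE DESCENT, HF-G34, gen-3); this generation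
files the two remaining off-gate companions of that family: PROPOSITION D′ at the prime levels (the second theorem of the HF-G32
gate record itself, `DecodingDPrime` / `DPrimePrimeFinal`) and THE DESCENT AT THE LEVELS 15N AND 21N (HF-G34b, `DescentB` /
`DescentBFinal`).
GATE HF-G34b (pub-hodgefermat `CERT.md` l.993 / `GATE.md` l.2063): lake-only in the sibling (`lake build HodgeFermat.DescentBFinal`;
its shape elaborated on the hub against stand-ins, scratch `ShapeFinal_g34b_standalone.lean` sha256 `d8630e469078…` rc 0), here an
ordinary module on top of `HodgeFermatDescentBA/BB.lean` and the landed THEOREM KR6 / U⁺ / F*(3N) (`HodgeFermatPropDPrimeNFinal.lean`).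
Deviations from the source module, exhaustively: the `import` lines (`…HodgeFermatDescentBB` for `import HodgeFermat.DescentB`,
`…HodgeFermatPropDPrimeNFinal` for `import HodgeFermat.PropDPrimeNFinal`); this module docstring (the source's copyright comment l.1–3
and docstring l.7–18 quoted below); AFTER the source's last declaration and before its `end` line TWO theorems are added:
`descent15_holds : Descent15`, `descent21_holds : Descent21` — the statements filed first (`HodgeFermatDescentBStatement.lean`, the
universal closures of `descent15`'s / `descent21`'s signatures) closed by `descent15` / `descent21` themselves (λ re-packaging of the
binders, no other content).  Every other line — in particular every declaration's statement and proof — is byte-identical to the source.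
Trust base: the ONLY hypothesis of every theorem here is `JP 15` resp. `JP 21` (explicit in each signature and in the statements
`Descent15` / `Descent21`; (JP_m₀) = THEOREM F15⁺/F21⁺'s analytic half, DPRIME §13.2–13.5, NOT in the kernel); no `sorry`;
axioms = [propext, Classical.choice, Quot.sound].
HONEST FRAMING: explicit algebraic cycles for specific Hodge classes on Fermat/Delsarte varieties; residual open instances
listed; no claim on general Hodge.  (This file is arithmetic of CM types / finite combinatorics of the sibling's KR-free
programme; it claims nothing about cycles.)

The source module's copyright comment (l.1–3: its one line of text) and docstring (l.7–18), verbatim: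

Copyright: pub-hodgefermat build (speedrun `hodge-fermat`), generation 34 (second gate), 2026-08-22.

## THE DESCENT AT THE LEVELS 15N AND 21N from (JP₁₅)/(JP₂₁) alone (HF-G34b; `lake build` form)

`DescentB.descent15` / `descent21` / `noCoincidence15` / `noCoincidence21` with the three THEOREMS among their hypotheses
discharged — THEOREM KR6 `TheoremZ3U.kr6'` (`TheoremZ3UFinal`), THEOREM U⁺ `PropDPrimeNFinal.thmUPlus'` (`TheoremUPlusFinal` via
`TheoremUEqFinal`), THEOREM F\*(3N) `PropDPrimeNFinal.fstar` (`ThmFstarNFinal`) — so that the ONLY remaining hypothesis is the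
§13.1 statement `(JP₁₅)` resp. `(JP₂₁)` (`DescentB.JP 15` / `JP 21`): THEOREM F15⁺/F21⁺ of `tables/DPRIME-THEOREM.md` §13 REDUCED,
in the kernel, to its jointly primitive core.  Like `PropDPrimeNFinal` (whose import closure it shares, plus `DescentB`) this module
has NO hub record of its own (its one-file concatenation exceeds the 512 KiB cap); its SHAPE was elaborated on the hub against
stand-in axioms with the verbatim statements (seat scratch `ShapeFinal_g34b`), and it is checked as a whole by
`lake build HodgeFermat.DescentBFinal` only.  NOT imported by the root `HodgeFermat.lean`.
-/

set_option autoImplicit false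

namespace HodgeFermat.KRFree.DescentBFinal

open HodgeFermat.KRFree.LemmaN
open HodgeFermat.KRFree.CoincFull (InClass)
open HodgeFermat.KRFree.PropDPrimeN (units39)
open HodgeFermat.KRFree.PropDPrimeNFinal (fstar thmUPlus')
open HodgeFermat.KRFree.DescentB (JP big15 big21)

/-- **THE DESCENT AT LEVEL 15N from (JP₁₅)** — `N > 0` squarefree, all primes `≥ 11`; a disjoint coincidence of CM types at level
`15N` (no entry `≡ 0`) is `5g` times a level-39 unit pair (`N = 13g`) or `N` times a pair of one of the two big classes mod `15`. -/
theorem descent15 (hJP : JP 15) {N : ℕ} (hN : 0 < N) (hsq : Squarefree N) (h11 : ∀ p ∈ N.primeFactors, 11 ≤ p)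
    {a b c a' b' c' : ℕ}
    (hs : 15 * N ∣ a + b + c) (ha : ¬ 15 * N ∣ a) (hb : ¬ 15 * N ∣ b) (hc : ¬ 15 * N ∣ c)
    (hs' : 15 * N ∣ a' + b' + c') (ha' : ¬ 15 * N ∣ a') (hb' : ¬ 15 * N ∣ b') (hc' : ¬ 15 * N ∣ c')
    (hD : ∀ u v, (u = a ∨ u = b ∨ u = c) → (v = a' ∨ v = b' ∨ v = c') → ¬ u ≡ v [MOD 15 * N])
    (hH : SameType (15 * N) (a, b, c) (a', b', c')) :
    (∃ g, N = 13 * g ∧ 5 * g ∣ a ∧ 5 * g ∣ b ∧ 5 * g ∣ c ∧ 5 * g ∣ a' ∧ 5 * g ∣ b' ∧ 5 * g ∣ c' ∧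
      ∃ cl ∈ units39, InClass cl (a / (5 * g) % 39) (b / (5 * g) % 39) (c / (5 * g) % 39) ∧
        InClass cl (a' / (5 * g) % 39) (b' / (5 * g) % 39) (c' / (5 * g) % 39)) ∨
    (N ∣ a ∧ N ∣ b ∧ N ∣ c ∧ N ∣ a' ∧ N ∣ b' ∧ N ∣ c' ∧
      ∃ cl ∈ big15, InClass cl (a / N % 15) (b / N % 15) (c / N % 15) ∧
        InClass cl (a' / N % 15) (b' / N % 15) (c' / N % 15)) :=
  DescentB.descent15 TheoremZ3U.kr6' thmUPlus' fstar hJP hN hsq h11 hs ha hb hc hs' ha' hb' hc' hD hH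

/-- **no disjoint coincidence at level `15N` off the level-15 list, `13 ∤ N`, from (JP₁₅)** -/
theorem noCoincidence15 (hJP : JP 15) {N : ℕ} (hN : 0 < N) (hsq : Squarefree N) (h11 : ∀ p ∈ N.primeFactors, 11 ≤ p)
    (h13 : ¬ 13 ∣ N) {a b c a' b' c' : ℕ}
    (hs : 15 * N ∣ a + b + c) (ha : ¬ 15 * N ∣ a) (hb : ¬ 15 * N ∣ b) (hc : ¬ 15 * N ∣ c)
    (hs' : 15 * N ∣ a' + b' + c') (ha' : ¬ 15 * N ∣ a') (hb' : ¬ 15 * N ∣ b') (hc' : ¬ 15 * N ∣ c')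
    (hD : ∀ u v, (u = a ∨ u = b ∨ u = c) → (v = a' ∨ v = b' ∨ v = c') → ¬ u ≡ v [MOD 15 * N])
    (hH : SameType (15 * N) (a, b, c) (a', b', c')) :
    N ∣ a ∧ N ∣ b ∧ N ∣ c ∧ N ∣ a' ∧ N ∣ b' ∧ N ∣ c' ∧
      ∃ cl ∈ big15, InClass cl (a / N % 15) (b / N % 15) (c / N % 15) ∧
        InClass cl (a' / N % 15) (b' / N % 15) (c' / N % 15) :=
  DescentB.noCoincidence15 TheoremZ3U.kr6' thmUPlus' fstar hJP hN hsq h11 h13 hs ha hb hc hs' ha' hb' hc' hD hH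

/-- **THE DESCENT AT LEVEL 21N from (JP₂₁)** — as `descent15` with `7` for `5` and the two big classes mod `21`. -/
theorem descent21 (hJP : JP 21) {N : ℕ} (hN : 0 < N) (hsq : Squarefree N) (h11 : ∀ p ∈ N.primeFactors, 11 ≤ p)
    {a b c a' b' c' : ℕ}
    (hs : 21 * N ∣ a + b + c) (ha : ¬ 21 * N ∣ a) (hb : ¬ 21 * N ∣ b) (hc : ¬ 21 * N ∣ c)
    (hs' : 21 * N ∣ a' + b' + c') (ha' : ¬ 21 * N ∣ a') (hb' : ¬ 21 * N ∣ b') (hc' : ¬ 21 * N ∣ c')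
    (hD : ∀ u v, (u = a ∨ u = b ∨ u = c) → (v = a' ∨ v = b' ∨ v = c') → ¬ u ≡ v [MOD 21 * N])
    (hH : SameType (21 * N) (a, b, c) (a', b', c')) :
    (∃ g, N = 13 * g ∧ 7 * g ∣ a ∧ 7 * g ∣ b ∧ 7 * g ∣ c ∧ 7 * g ∣ a' ∧ 7 * g ∣ b' ∧ 7 * g ∣ c' ∧
      ∃ cl ∈ units39, InClass cl (a / (7 * g) % 39) (b / (7 * g) % 39) (c / (7 * g) % 39) ∧
        InClass cl (a' / (7 * g) % 39) (b' / (7 * g) % 39) (c' / (7 * g) % 39)) ∨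
    (N ∣ a ∧ N ∣ b ∧ N ∣ c ∧ N ∣ a' ∧ N ∣ b' ∧ N ∣ c' ∧
      ∃ cl ∈ big21, InClass cl (a / N % 21) (b / N % 21) (c / N % 21) ∧
        InClass cl (a' / N % 21) (b' / N % 21) (c' / N % 21)) :=
  DescentB.descent21 TheoremZ3U.kr6' thmUPlus' fstar hJP hN hsq h11 hs ha hb hc hs' ha' hb' hc' hD hH

/-- **no disjoint coincidence at level `21N` off the level-21 list, `13 ∤ N`, from (JP₂₁)** -/
theorem noCoincidence21 (hJP : JP 21) {N : ℕ} (hN : 0 < N) (hsq : Squarefree N) (h11 : ∀ p ∈ N.primeFactors, 11 ≤ p)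
    (h13 : ¬ 13 ∣ N) {a b c a' b' c' : ℕ}
    (hs : 21 * N ∣ a + b + c) (ha : ¬ 21 * N ∣ a) (hb : ¬ 21 * N ∣ b) (hc : ¬ 21 * N ∣ c)
    (hs' : 21 * N ∣ a' + b' + c') (ha' : ¬ 21 * N ∣ a') (hb' : ¬ 21 * N ∣ b') (hc' : ¬ 21 * N ∣ c')
    (hD : ∀ u v, (u = a ∨ u = b ∨ u = c) → (v = a' ∨ v = b' ∨ v = c') → ¬ u ≡ v [MOD 21 * N])
    (hH : SameType (21 * N) (a, b, c) (a', b', c')) :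
    N ∣ a ∧ N ∣ b ∧ N ∣ c ∧ N ∣ a' ∧ N ∣ b' ∧ N ∣ c' ∧
      ∃ cl ∈ big21, InClass cl (a / N % 21) (b / N % 21) (c / N % 21) ∧
        InClass cl (a' / N % 21) (b' / N % 21) (c' / N % 21) :=
  DescentB.noCoincidence21 TheoremZ3U.kr6' thmUPlus' fstar hJP hN hsq h11 h13 hs ha hb hc hs' ha' hb' hc' hD hH

/-- **THE DESCENT AT LEVEL 15N from (JP₁₅) — holds**: the statement `Descent15` filed first (`HodgeFermatDescentBStatement.lean`,
count-neutral; its antecedent is `JP 15`) is closed by `descent15` above (binders re-packaged, nothing else).  Conditional on (JP₁₅)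
BY CONSTRUCTION of the statement; no other hypothesis; axioms = [propext, Classical.choice, Quot.sound]. -/
theorem descent15_holds : Descent15 :=
  fun hJP _ hN hsq h11 _ _ _ _ _ _ hs ha hb hc hs' ha' hb' hc' hD hH =>
    descent15 hJP hN hsq h11 hs ha hb hc hs' ha' hb' hc' hD hH

/-- **THE DESCENT AT LEVEL 21N from (JP₂₁) — holds**: the statement `Descent21` (antecedent `JP 21`) is closed by `descent21` above. -/
theorem descent21_holds : Descent21 :=
  fun hJP _ hN hsq h11 _ _ _ _ _ _ hs ha hb hc hs' ha' hb' hc' hD hH =>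
    descent21 hJP hN hsq h11 hs ha hb hc hs' ha' hb' hc' hD hH

end HodgeFermat.KRFree.DescentBFinal
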